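import Literature.AnabelianGeometry.SemiGraphs.TemperedTorsionPointsSchemaNegative
import Literature.AnabelianGeometry.SemiGraphs.TemperedOriginSchemaNegative
import Literature.AnabelianGeometry.SemiGraphs.TemperedCurveGroupLevelDataNonVacuity2
import HarnessLib

/-!
# [SemiAnbd] Thm. 6.8 (iii): `TorsionPointData` and `TemperedTorsionOrigin` inhabited; the typed
# statement evaluated at kernel data (non-vacuity)

Mochizuki, *Semi-graphs of anabelioids*, Publ. RIMS **42** (2006) [SemiAnbd], §6, Theorem 6.8 (iii),
author's manuscript p. 75 [cite: MochizukiSemiAnbd2006, Thm 6.8(iii) p.75].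

PROOF-ONLY file (abc-iut cell, layer L3, NV lane; seat abc-iut-w6-d108, row «NV-L3 TorsionPointData +
TemperedTorsionOrigin», abc-iut-L3-lead (gen 5) α53; theorems only — no `def`, no `instance`, no new
named fact).  The two structures of `TemperedTorsionPoints.lean` (abc-iut-L3-t4) —
`TemperedCurve.TorsionPointData X a` (the parametrisation of the torsion closed points of `X̄_K` by
`Δ_X^ab ⊗ ℚ/ℤ`) and the ORIGIN certificate `TemperedTorsionOrigin p` — had no `Nonempty`/`∃` producer
in the INHABITATION-CENSUS-L3 v2/v3 (abc-iut-w4-d098 b6b2ecaaf2382289 / abc-iut-w5-d197 2319d04b441add97).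
Contents:

* GENERAL producers: `TorsionPointData X a` is inhabited iff the torsion locus `{x | a.IsTorsionPt x}` is
  the range of a map from `Δ_X^ab ⊗ ℚ/ℤ`, iff it is nonempty of cardinality `≤ #(Δ_X^ab ⊗ ℚ/ℤ)`
  (`nonempty_iff_cardinalMk_le`); in particular whenever it is a singleton.
* SANITY of the typed Thm. 6.8 (iii) predicates at `α = id` for EVERY datum: `PreservesDecompOf`,
  `IsoPreservesTorsionDecomp` and `IsoTorsionBijectionTateCompatible` hold for the identity (the latter
  uses that a lift `α̂` of `id` fixes `Δ_X ⊆ Π̂` pointwise — `Π̂` is Hausdorff and `Δ_X` is the closure of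
  the image of `Δ^temp` — so the induced Tate-module map is the identity).
* KERNEL DATA: `TorsionPointData` at abc-iut-w5-d040's toy (`toyHyperbolic`, one cusp) and at the
  GENUINE §6 datum of `exists_temperedCurve_groupLevelData_genuine` (the cusp flagged as the torsion
  closed point — for `X = E ∖ {O}` the cusp `O` IS a torsion closed point; the other torsion orbits of
  print are not modelled there).  The principal `TemperedTorsionOrigin` at that datum with the EMPTY
  torsion certificate (so `TorsionPointsHolds` VACUOUS, honestly) is abc-iut-w6-d055's
  `TemperedTorsionOrigin.exists_principal_genuine` (OriginCertificatesNonVacuity.lean, p432071) and is not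
  repeated; here: every `TemperedMorphismOrigin` extends with any prescribed torsion certificate
  (`exists_extends`), and the vacuity mechanism is isolated (`torsionPointsHolds_of_forall_not_isFlagsOrigin`).
* A NON-VACUOUS POSITIVE instance complementing abc-iut-f-056's refutation of the `∀Ω`-closure
  (`not_forall_torsionPointsHolds`, p430758): at the one-point junk datum with decomposition group
  `Π^temp` itself, `TorsionPointsHolds` HOLDS at the ALL-certifying principal origin, for EVERY `α`
  (`exists_allCertifying_torsionPointsHolds`).

HONEST FRAMING.  Certificates at kernel MODELS are consistency / non-vacuity evidence for the typed §6
package; none of them is André's `π₁^temp` of a once-punctured elliptic curve; nothing of [SemiAnbd] is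
asserted or denied for curves; typed ≠ proved; no side is taken on [IUTchIII] Cor. 3.12.
-/

noncomputable section

namespace Literature.AnabelianGeometry.SemiGraphs

open scoped Pointwise TensorProduct
open _root_.Topology

universe u

variable {p : ℕ} [Fact p.Prime]

namespace TemperedCurve

/-! ### General producers for `TorsionPointData` -/

/-- A torsion-point parametrisation forces the torsion locus to be nonempty (`0 ∈ Δ_X^ab ⊗ ℚ/ℤ` has an
image). [cite: MochizukiSemiAnbd2006, Thm 6.8(iii) p.75] -/
theorem TorsionPointData.exists_isTorsionPt {X : TemperedCurve p} {a : CurveArithmeticFlags X}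
    (T : TorsionPointData X a) : ∃ x, a.IsTorsionPt x := by
  have h : T.torsionPt 0 ∈ Set.range T.torsionPt := ⟨0, rfl⟩
  rw [T.range_torsionPt] at h
  exact ⟨_, h⟩

/-- `TorsionPointData X a` is inhabited iff the torsion locus is the range of SOME map from
`Δ_X^ab ⊗ ℚ/ℤ` (the structure has no further axiom). [cite: MochizukiSemiAnbd2006, Thm 6.8(iii) p.75] -/
theorem TorsionPointData.nonempty_iff_exists_range_eq (X : TemperedCurve p) (a : CurveArithmeticFlags X) :
    Nonempty (TorsionPointData X a) ↔
      ∃ f : TorsionModule X → X.Pt, Set.range f = {x | a.IsTorsionPt x} :=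
  ⟨fun ⟨T⟩ => ⟨T.torsionPt, T.range_torsionPt⟩, fun ⟨f, hf⟩ => ⟨⟨f, hf⟩⟩⟩

/-- If the torsion locus is a single closed point `x₀`, the constant parametrisation is a
`TorsionPointData`. [cite: MochizukiSemiAnbd2006, Thm 6.8(iii) p.75] -/
theorem TorsionPointData.nonempty_of_forall_iff_eq {X : TemperedCurve p} {a : CurveArithmeticFlags X}
    (x₀ : X.Pt) (h : ∀ x, a.IsTorsionPt x ↔ x = x₀) : Nonempty (TorsionPointData X a) :=
  ⟨⟨fun _ => x₀, by rw [Set.range_const]; ext x; simpa using (h x).symm⟩⟩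

/-- **Cardinality criterion.**  `TorsionPointData X a` is inhabited iff the torsion locus is nonempty
and has cardinality at most that of `Δ_X^ab ⊗ ℚ/ℤ` (a nonempty set is the range of a map from `M` iff
it injects into `M`). [cite: MochizukiSemiAnbd2006, Thm 6.8(iii) p.75] -/
theorem TorsionPointData.nonempty_iff_cardinalMk_le (X : TemperedCurve p) (a : CurveArithmeticFlags X) :
    Nonempty (TorsionPointData X a) ↔
      (∃ x, a.IsTorsionPt x) ∧
        Cardinal.mk {x // a.IsTorsionPt x} ≤ Cardinal.mk (TorsionModule X) := by
  constructor
  · rintro ⟨T⟩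
    refine ⟨T.exists_isTorsionPt, ?_⟩
    have hsurj : Function.Surjective (fun t : TorsionModule X =>
        (⟨T.torsionPt t, by
          have : T.torsionPt t ∈ Set.range T.torsionPt := ⟨t, rfl⟩
          rwa [T.range_torsionPt] at this⟩ : {x // a.IsTorsionPt x})) := by
      rintro ⟨x, hx⟩
      have hx' : x ∈ Set.range T.torsionPt := by rw [T.range_torsionPt]; exact hx
      obtain ⟨t, rfl⟩ := hx'
      exact ⟨t, rfl⟩
    exact Cardinal.mk_le_of_surjective hsurj
  · rintro ⟨⟨x₀, hx₀⟩, hle⟩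
    obtain ⟨e⟩ := (Cardinal.le_def _ _).1 hle
    haveI : Nonempty {x // a.IsTorsionPt x} := ⟨⟨x₀, hx₀⟩⟩
    refine ⟨⟨fun t => (Function.invFun e t).1, ?_⟩⟩
    ext x
    constructor
    · rintro ⟨t, rfl⟩
      exact (Function.invFun e t).2
    · intro hx
      exact ⟨e ⟨x, hx⟩, by simp only [Function.leftInverse_invFun e.injective ⟨x, hx⟩]⟩

/-! ### The typed Thm. 6.8 (iii) predicates at `α = id` (every datum) -/

/-- "Preserves the decomposition groups" is reflexive: the identity carries the classes of `S` onto
themselves. [cite: MochizukiSemiAnbd2006, Thm 6.8 p.74] -/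
theorem preservesDecompOf_refl (X : TemperedCurve p) (S : Set X.Pt) :
    PreservesDecompOf X X (ContinuousMulEquiv.refl _) S S := by
  intro D
  rw [map_refl_eq]

/-- Thm. 6.8 (iii), first sentence, holds for `α = id` at every datum and every flag tuple.
[cite: MochizukiSemiAnbd2006, Thm 6.8(iii) p.75] -/
theorem isoPreservesTorsionDecomp_refl (X : TemperedCurve p) (a : CurveArithmeticFlags X) :
    IsoPreservesTorsionDecomp X X a a (ContinuousMulEquiv.refl _) :=
  fun _ _ => X.preservesDecompOf_refl _

/-- An automorphism of `Δ_X` which is pointwise the identity induces the identity on `Δ_X^ab ⊗ ℚ/ℤ`.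
[cite: MochizukiSemiAnbd2006, Thm 6.8(iii) p.75] -/
theorem torsionMap_eq_self_of_forall_eq {X : TemperedCurve p} (β : X.DeltaHat ≃ₜ* X.DeltaHat)
    (h : ∀ d, β d = d) (t : TorsionModule X) : torsionMap β t = t := by
  have hβ : β.toMulEquiv.toMonoidHom = MonoidHom.id _ := MonoidHom.ext h
  have h1 : (deltaHatAbMap β).toIntLinearMap = LinearMap.id := by
    apply LinearMap.ext
    intro x
    change Additive.ofMul (Abelianization.map β.toMulEquiv.toMonoidHom (Additive.toMul x)) = x
    rw [hβ, Abelianization.map_id]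
    rfl
  change TensorProduct.map (deltaHatAbMap β).toIntLinearMap LinearMap.id t = t
  rw [h1, TensorProduct.map_id]
  rfl

/-- **Thm. 6.8 (iii), second sentence, holds for `α = id`** at every datum, flag tuple and torsion
parametrisation: a lift `α̂` of `id` with `α̂ ∘ ι = ι` fixes `Δ_X` pointwise (`Π̂` is Hausdorff and `Δ_X` is
the closure of `ι(Δ^temp)`), so the restricted `β` is the identity and so is the Tate-module map.
[cite: MochizukiSemiAnbd2006, Thm 6.8(iii) p.75] -/
theorem isoTorsionBijectionTateCompatible_refl (X : TemperedCurve p) (a : CurveArithmeticFlags X)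
    (T : TorsionPointData X a) :
    IsoTorsionBijectionTateCompatible X X a a T T (ContinuousMulEquiv.refl _) := by
  intro _ _ αhat hαhat β hβ t
  haveI : T2Space X.PiHat := X.isProfiniteCompletion_toHat.t2Space
  have hsub : (X.DeltaHat : Set X.PiHat) ⊆ {y | αhat y = y} := by
    rw [TemperedCurve.DeltaHat, Subgroup.topologicalClosure_coe]
    refine closure_minimal ?_ (isClosed_eq αhat.continuous continuous_id)
    rintro _ ⟨g, -, rfl⟩
    exact hαhat g
  have hβid : ∀ d : X.DeltaHat, β d = d := fun d => Subtype.ext ((hβ d).trans (hsub d.2))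
  refine ⟨1, ?_⟩
  rw [one_smul, torsionMap_eq_self_of_forall_eq β hβid t, map_refl_eq]

/-! ### Data all of whose decomposition groups are `Π^temp` itself: Thm. 6.8 (iii) holds for every `α` -/

/-- Conjugation fixes the top subgroup (cf. `PSCDatum.conjAct_smul_top`, not in this import closure).
[folklore] -/
private theorem conjAct_smul_top {G : Type u} [Group G] (γ : ConjAct G) : γ • (⊤ : Subgroup G) = ⊤ :=
  top_le_iff.1 fun _ _ => Subgroup.mem_pointwise_smul_iff_inv_smul_mem.2 (Subgroup.mem_top _)

/-- An isomorphism maps a subgroup onto `⊤` iff the subgroup is `⊤`. [folklore] -/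
private theorem map_continuousMulEquiv_eq_top_iff {G H : Type u} [Group G] [Group H] [TopologicalSpace G]
    [TopologicalSpace H] (α : G ≃ₜ* H) (D : Subgroup G) :
    D.map α.toMulEquiv.toMonoidHom = ⊤ ↔ D = ⊤ := by
  constructor
  · intro h
    rw [← Subgroup.comap_map_eq_self_of_injective (f := α.toMulEquiv.toMonoidHom) α.injective D, h,
      Subgroup.comap_top]
  · rintro rfl
    exact Subgroup.map_top_of_surjective _ α.surjective

/-- If every decomposition group of `X` and of `Y` is the whole tempered group, every `α` "preserves the
decomposition groups" of any two NONEMPTY classes of closed points (both sides of the defining `↔` say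
`D = Π^temp`). [cite: MochizukiSemiAnbd2006, Thm 6.8 p.74] -/
theorem preservesDecompOf_of_decomp_eq_top {X Y : TemperedCurve p} (hX : ∀ x, X.decomp x = ⊤)
    (hY : ∀ y, Y.decomp y = ⊤) (α : X.PiTemp ≃ₜ* Y.PiTemp) {S : Set X.Pt} {T : Set Y.Pt}
    (hS : S.Nonempty) (hT : T.Nonempty) : PreservesDecompOf X Y α S T := by
  intro D
  obtain ⟨x, hx⟩ := hS
  obtain ⟨y, hy⟩ := hT
  simp only [hX, hY, conjAct_smul_top, exists_const]
  constructor
  · rintro ⟨_, -, rfl⟩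
    exact ⟨y, hy, (map_continuousMulEquiv_eq_top_iff α ⊤).2 rfl⟩
  · rintro ⟨_, -, h⟩
    exact ⟨x, hx, (map_continuousMulEquiv_eq_top_iff α D).1 h⟩

/-- … hence Thm. 6.8 (iii), BOTH sentences as typed, hold there for every `α`, all flags and all torsion
parametrisations (the torsion loci are nonempty by `TorsionPointData.exists_isTorsionPt`).
[cite: MochizukiSemiAnbd2006, Thm 6.8(iii) p.75] -/
theorem thm68iii_of_decomp_eq_top {X Y : TemperedCurve p} (hX : ∀ x, X.decomp x = ⊤)
    (hY : ∀ y, Y.decomp y = ⊤) (aX : CurveArithmeticFlags X) (aY : CurveArithmeticFlags Y)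
    (TX : TorsionPointData X aX) (TY : TorsionPointData Y aY) (α : X.PiTemp ≃ₜ* Y.PiTemp) :
    IsoPreservesTorsionDecomp X Y aX aY α ∧ IsoTorsionBijectionTateCompatible X Y aX aY TX TY α := by
  refine ⟨fun _ _ => preservesDecompOf_of_decomp_eq_top hX hY α TX.exists_isTorsionPt
    TY.exists_isTorsionPt, fun _ _ _ _ _ _ t => ⟨1, ?_⟩⟩
  rw [one_smul, hX, hY]
  exact Subgroup.map_top_of_surjective _ α.surjective

/-- JUNK DATUM (not the datum of any curve): `TemperedCurve.degenerate p` (`Π^temp = Π̂ = G_{ℚ_p}`,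
`Δ^temp = 1`) with ONE closed point, non-cuspidal, with decomposition group `Π^temp` itself (closed,
surjects onto `G_{ℚ_p}`, `I_x = 1`); all interface clauses hold.  Its torsion module is a quotient of
`1^ab ⊗ ℚ/ℤ`, and the one point is parametrised by the constant map.
[cite: MochizukiSemiAnbd2006, §6 pp.69-71] -/
theorem exists_onePoint_decomp_eq_top :
    ∃ X : TemperedCurve p, Nonempty X.Pt ∧ (∀ x y : X.Pt, x = y) ∧ ∀ x, X.decomp x = ⊤ := by
  refine ⟨{ degenerate p with
    Pt := Unit
    IsCusp := fun _ => False
    decomp := fun _ => ⊤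
    isClosed_decomp := fun _ => ?_
    isOpen_aug_decomp := fun _ => ?_
    inertia_eq_bot := fun _ _ => ?_
    inertia_equiv_zHat := fun _ h => h.elim }, ⟨()⟩, fun _ _ => rfl, fun _ => rfl⟩
  · change IsClosed (((⊤ : Subgroup (GQp p)) : Set (GQp p)))
    rw [Subgroup.coe_top]
    exact isClosed_univ
  · change IsOpen ((ContinuousMonoidHom.id (GQp p)) '' ((⊤ : Subgroup (GQp p)) : Set (GQp p)))
    simp
  · change (⊤ : Subgroup (GQp p)) ⊓ (ContinuousMonoidHom.id (GQp p)).toMonoidHom.ker = ⊥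
    rw [top_inf_eq]
    exact (MonoidHom.ker_eq_bot_iff _).mpr Function.injective_id

/-! ### `TorsionPointData` at kernel data -/

/-- At abc-iut-w5-d040's toy `toyHyperbolic p` (`Π^temp = G_{ℚ_p} × Ẑ × P`, one closed point, a cusp):
any flags declaring that point a torsion closed point carry a `TorsionPointData` (constant
parametrisation). [cite: MochizukiSemiAnbd2006, Thm 6.8(iii) p.75] -/
theorem nonempty_torsionPointData_toyHyperbolic (a : CurveArithmeticFlags (toyHyperbolic p))
    (h : a.IsTorsionPt ()) : Nonempty (TorsionPointData (toyHyperbolic p) a) :=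
  TorsionPointData.nonempty_of_forall_iff_eq () fun x => by cases x; simpa using h

/-- The toy carries once-punctured-elliptic flags with the cusp as torsion closed point, and torsion
data for them. [cite: MochizukiSemiAnbd2006, Thm 6.8(iii) p.75] -/
theorem exists_flags_torsionPointData_toyHyperbolic :
    ∃ a : CurveArithmeticFlags (toyHyperbolic p), a.IsOncePuncturedElliptic ∧
      (∀ x, a.IsTorsionPt x ↔ (toyHyperbolic p).IsCusp x) ∧ Nonempty (TorsionPointData (toyHyperbolic p) a) :=
  ⟨⟨True, fun _ => True, True, fun _ => True, True⟩, trivial, fun _ => Iff.rfl,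
    nonempty_torsionPointData_toyHyperbolic _ trivial⟩

/-- **At the GENUINE §6 datum** of `exists_temperedCurve_groupLevelData_genuine` (abc-iut-w5-d040,
p425993: `K = ℚ_p`, `Π^temp = G_{ℚ_p} × F̂₂` compact, `Δ^temp` nonabelian slim, a cusp `c`): the flags
"once-punctured elliptic, torsion locus `= {c}`" carry a `TorsionPointData`.  (For `X = E ∖ {O}` the cusp
`O` is a torsion closed point; print's other torsion orbits are not modelled at this datum.)
[cite: MochizukiSemiAnbd2006, Thm 6.8(iii) p.75] -/
theorem exists_torsionPointData_genuine (p : ℕ) [Fact p.Prime] :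
    ∃ (X : TemperedCurve p) (a : CurveArithmeticFlags X),
      X.K = ⊥ ∧ Function.Surjective X.aug ∧ Nonempty X.GroupLevelData ∧ CompactSpace X.PiTemp ∧
      (∃ g ∈ X.DeltaTemp, ∃ h ∈ X.DeltaTemp, g * h ≠ h * g) ∧
      a.IsOncePuncturedElliptic ∧ (∃ c : X.Pt, X.IsCusp c ∧ ∀ x, a.IsTorsionPt x ↔ x = c) ∧
      Nonempty (TorsionPointData X a) := by
  obtain ⟨X, hK, haug, hGLD, ⟨c, hc⟩, hnab, -, -, hcpt, -⟩ := exists_temperedCurve_groupLevelData_genuine p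
  exact ⟨X, ⟨True, fun x => x = c, True, fun _ => True, True⟩, hK, haug, hGLD, hcpt, hnab, trivial,
    ⟨c, hc, fun _ => Iff.rfl⟩, TorsionPointData.nonempty_of_forall_iff_eq c fun _ => Iff.rfl⟩

end TemperedCurve

/-! ### `TemperedTorsionOrigin` inhabited; `TorsionPointsHolds` evaluated -/

namespace TemperedTorsionOrigin

open TemperedCurve

/-- Every `TemperedMorphismOrigin` extends to a `TemperedTorsionOrigin` with ANY prescribed torsion
certificate. [cite: MochizukiSemiAnbd2006, Thm 6.8(iii) p.75] -/
theorem exists_extends (Ω : TemperedMorphismOrigin p)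
    (P : ∀ {X : TemperedCurve p} {a : CurveArithmeticFlags X}, TorsionPointData X a → Prop) :
    ∃ Ω' : TemperedTorsionOrigin p, Ω'.toTemperedMorphismOrigin = Ω ∧
      ∀ (X : TemperedCurve p) (a : CurveArithmeticFlags X) (T : TorsionPointData X a),
        Ω'.IsTorsionPtOrigin T ↔ P T :=
  ⟨⟨Ω, P⟩, rfl, fun _ _ _ => Iff.rfl⟩

/-- If NO arithmetic-flag tuple is certified, Thm. 6.8 (iii) `…Holds` is vacuous.
[cite: MochizukiSemiAnbd2006, Thm 6.8(iii) p.75] -/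
theorem torsionPointsHolds_of_forall_not_isFlagsOrigin (Ω : TemperedTorsionOrigin p)
    (h : ∀ (X : TemperedCurve p) (a : CurveArithmeticFlags X), ¬ Ω.IsFlagsOrigin a) :
    Ω.TorsionPointsHolds :=
  fun X _ aX _ _ _ _ _ haX => (h X aX haX).elim

/-- **NON-VACUOUS POSITIVE INSTANCE** (contrast `TemperedCurve.not_forall_torsionPointsHolds`, p430758):
at the one-point junk datum `X` of `exists_onePoint_decomp_eq_top`, the principal origin certifying `X`
together with ALL flag tuples and ALL torsion parametrisations satisfies `TorsionPointsHolds` — Thm. 6.8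
(iii) as typed holds there for EVERY `α : Π^temp ⥲ Π^temp`, and torsion data exist.
[cite: MochizukiSemiAnbd2006, Thm 6.8(iii) p.75] -/
theorem exists_allCertifying_torsionPointsHolds (p : ℕ) [Fact p.Prime] :
    ∃ (X : TemperedCurve p) (Ω : TemperedTorsionOrigin p),
      (∀ Y, Ω.IsHyperbolicCurveOrigin Y ↔ Y = X) ∧
      (∀ (Y : TemperedCurve p) (a : Y.CurveArithmeticFlags), Ω.IsFlagsOrigin a) ∧
      (∀ (Y : TemperedCurve p) (a : Y.CurveArithmeticFlags) (T : TorsionPointData Y a),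
        Ω.IsTorsionPtOrigin T) ∧
      (∃ a : X.CurveArithmeticFlags, a.IsOncePuncturedElliptic ∧ Nonempty (TorsionPointData X a)) ∧
      Ω.TorsionPointsHolds := by
  obtain ⟨X, ⟨x₀⟩, hsub, htop⟩ := exists_onePoint_decomp_eq_top (p := p)
  refine ⟨X, ⟨⟨⟨fun Y => Y = X⟩, fun _ => True, fun _ => True, fun _ => True⟩, fun _ => True⟩,
    fun _ => Iff.rfl, fun _ _ => trivial, fun _ _ _ => trivial,
    ⟨⟨True, fun _ => True, True, fun _ => True, True⟩, trivial,
      TorsionPointData.nonempty_of_forall_iff_eq x₀ fun x => by simp [hsub x x₀]⟩, ?_⟩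
  rintro Y Z aY aZ TY TZ rfl rfl - - - - α
  exact thm68iii_of_decomp_eq_top htop htop aY aZ TY TZ α

end TemperedTorsionOrigin

end Literature.AnabelianGeometry.SemiGraphs

end
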